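import Summits.BirchSwinnertonDyer.BirchSwinnertonDyer.Theorems.ByReductionTypeAtTwoTowerFiltrationGap
import Summits.BirchSwinnertonDyer.BirchSwinnertonDyer.Theorems.ByReductionTypeAtTwoMultUpperHalfTowerCertAddv2
import HarnessLib

/-!
# Route `ByReductionTypeAtTwo`, crux `MultUpperHalfAtTwo` (item stmt-BirchSwinnertonDyer-19922): the TOWER road's decidable
# CERTIFICATE doors read off ONE layer's `2`-Selmer group WITH its `Gal(ℚ_n/ℚ)`-module structure (the «σ-lever»,
# seat bsd-2adic-mult-2 GEN 9)

HONEST FRAMING (cell `bsd-2adic`, run/shared/lean/pub/bsd-2adic/, HUMAN RULINGS D-0036 / D-0054 / D-0074): research route;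
THEOREMS ONLY (no definition, no new named fact); nothing is booked; BSD is not proved by any of this. PARTITION: X5@2 mult
(K4ᵐ, RESIDUAL-MAP B1·O1; the 540 `E[2]`-irreducible rank-0 classes with no class file after GEN 8) × p = 2 —
types-the-object-of (a sharper per-class certificate format); closes none. bears_on: K4 (item 19922).

WHY. Every tower door so far certifies the gap `#X/(2,T^{2^{j'}})X < 2^{2^{j'}−2^j} · #X/(2,T^{2^j})X` from TWO layer counts
`d_j, d_{j'}`: feasible iff `d_{j'} − d_j + Σ_{j'} < 2^{j'} − 2^j`, at `(0,3)` iff `λ + Σ₃ ≤ 8` — and ≈ 500 of the 540 open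
irreducible classes have `λ_an ≥ 5` with `Σ₃ ≥ 1`. `…TowerFiltrationGap` (this seat) proved that ONE layer `n` sees
`#X/(2,T^m)X` for EVERY `m ≤ 2ⁿ` as the number of classes of `Sel_{2^∞}(E/ℚ_n)[2]` killed by `(conj_γ − id)^[m]`
(`γ` a topological generator, acting on `H¹(ℚ_n, E[2^∞])` through `Gal(ℚ_n/ℚ)`), up to the SAME local error terms. So the
gap may be read off ANY window `[m, m+w] ⊆ [0, 2ⁿ]`: feasible iff `s(m+w) − s(m) + Σ_n < w`, i.e. (Jordan blocks
`b₁ ≥ b₂ ≥ …` of `T` on `X/2X`, `Σ bᵢ = λ`) iff `b₁ + Σ₃ ≤ 7` at `n = 3` — the second Λ-generator forced by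
`Ш(E/ℚ)[2] ≅ (ℤ/2)²` no longer costs. This file re-derives GEN 8's six-disjunct doors (`MultTowerAddv.…_addv2`) on that
primitive, everything else VERBATIM:

* §1 `towerGapAtTwo_of_filtration_numeric_atTwo` / `…_nat_atTwo` / `…_cert_atTwo` — `O1.TowerGapAtTwo W` for ANY globally
  minimal `W/ℚ` with odd torsion order from PRINT {`h33g`, `hM`, `hA`} + a displayed bound `h2 : #𝒦_{v,n}[2] ≤ C₂` at the place
  over `2` + the decidable odd-prime certificates (six disjuncts: `4`; mult `2`; mult with odd `ord_ℓ Δ` `1`; good `1`; additive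
  zero-bit `1`; additive potentially-good `2`) + the TWO FILTERED COUNTS `2^a ≤ #{z ∈ Sel_n[2] : ν^[m] z = 0}`,
  `#{z ∈ Sel_n[2] : ν^[m+w] z = 0} ≤ 2^d` + the arithmetic `2^d · C₂ · ∏_{ℓ ∈ P} C_ℓ^{2^{min(n, e_ℓ)}} < 2^{w + a}`.
* §2 the habitats at `v ∣ 2`, all KERNEL data except the non-split two-bit PRINT binder `hNS2`:
  `…_cert_nonsplitTwo_filt` (`C₂ = 4`, `hNS2`), `…_cert_nonsplitTwo_oneBit_filt` (`C₂ = 2`, Tate unit `≡ ±3 (8)`, tower-1's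
  `MultTowerNS2.atTwo_le_two_of_nonsplit_oneBit_kernel`), `…_cert_splitTwo_oneBit_filt` (`C₂ = 2`,
  `MultTowerCert.atTwo_le_two_of_split_oneBit_kernel`), `…_cert_splitTwo_zeroBit_filt` (`C₂ = 1`, Tate unit `≡ ±3 (8)`,
  `MultTowerCert.atTwo_le_one_of_split_zeroBit_kernel`).
A per-class file feeds the result to GEN 3's class theorem `missingUpperBoundAt_two_mult_of_towerGapMember'` exactly as before.

WHAT IS DISPLAYED, NOT PROVED: PRINT `h33g`/`hM`/`hA` (theorems in tree, dischargeable by name: RC-137), `hNS2` (non-split two-bit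
rows only); the CERTIFICATES `hlow`/`hup` = the two filtered counts (ENGINE A + the `S2| SIGMA` block of `sel2sigma.gp`
@e1514551dc256a24: the `(σ−1)`-filtration of `Sel₂(E/ℚ_n)`, `σ : ζ ↦ ζ³`; any generator gives the same filtration).

References: R. Greenberg, LNM 1716 (1999), §1 p. 60, §3 pp. 85–94; L. Washington, *Introduction to Cyclotomic Fields*, §13.1–13.2;
J. H. Silverman, AEC VII.1, VII.5; ATAEC IV.9 Table 4.1.
-/

set_option autoImplicit false
-- the Theorems namespace of this sub repeats the summit name by design (D-0017 nested layout: Summit.<S>.<Sub>)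
set_option linter.dupNamespace false

noncomputable section

open scoped Classical MatrixGroups ModularForm

open NumberField IsDedekindDomain CongruenceSubgroup WeierstrassCurve Literature.NumberTheory.EllipticCurves
  Literature.NumberTheory.EllipticCurves.ModularForms
  Literature.NumberTheory.EllipticCurves.Greenberg1999
  Literature.NumberTheory.EllipticCurves.Rank1Residual
  Literature.NumberTheory.EllipticCurves.Rank1Residual.Typed
  Literature.NumberTheory.GaloisRepresentations
  Summit.BirchSwinnertonDyer.Rank1Residual.X5 Summit.BirchSwinnertonDyer.Rank1Residual.X5.O1
  Summit.BirchSwinnertonDyer.Rank1Residual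
  Summit.BirchSwinnertonDyer.BirchSwinnertonDyer.Theorems.KatoHalfPinch
  Summit.BirchSwinnertonDyer.BirchSwinnertonDyer.Theorems.MultTowerAddv
  Rat.HeightOneSpectrum

namespace Summit.BirchSwinnertonDyer.BirchSwinnertonDyer.Theorems.MultTowerFilt

/-! ## §1 The filtration gap certificate with the constant at `2` an explicit datum (no reduction hypothesis at `2`) -/

section Gap

variable (W : WeierstrassCurve ℚ) [W.IsElliptic] [W.IsGloballyMinimal]

omit [W.IsGloballyMinimal] in
/-- **The FILTRATION GAP certificate with NUMERIC local constants, the constant at `2` a DATUM, SIX disjuncts.** `W/ℚ` with odd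
torsion order (ANY reduction type at `2`); ONE layer `n` and a window `m + w ≤ 2ⁿ`; `S` a finite set of finite places off which every
place is odd and good; PRINT `h33g`, `hM`, `hA`; a displayed bound `h2` at the place(s) over `2` by `C₂`; numeric constants `C_v` at
the odd `v ∈ S` justified by ONE of six disjuncts; the two FILTERED counts of `Sel_{2^∞}(E/ℚ_n)[2]` (`ν = conj_γ − id`);
arithmetic `2^d · ∏_{v ∈ S} (2 ∈ v ? C₂ : C_v)^{(2 ∈ v ? 1 : 2^{min(n, v₂(ℓ_v² − 1) − 3)})} < 2^{w + a}`. Then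
`O1.TowerGapAtTwo W` (`TowerFiltration.towerGapAtTwo_of_filtration_localKernelBounds_sharp`).
[cite: GreenbergLNM1716, §3 Lemmas 3.3–3.5 (PDF pp. 86–90) and pp. 90–93] [cite: SilvermanATAEC1994, IV.9 Table 4.1] -/
theorem towerGapAtTwo_of_filtration_numeric_atTwo
    (h33g : lemma33_localTowerKerPrimary_eq_bot_of_good.{0})
    (hM : lemma33_localTowerKerPrimary_cyclic_of_multiplicative.{0})
    (hA : lemma33_natCard_localTowerKerPrimary_le_four_of_additive.{0})
    (htors : ¬ 2 ∣ W.torsionOrder) {n m w a d : ℕ} (hmw : m + w ≤ 2 ^ n) (C₂ : ℕ)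
    (h2 : ∀ κ : ZpExtension ℚ 2, κ.IsCyclotomic → ∀ v : HeightOneSpectrum (𝓞 ℚ),
      ((2 : ℕ) : 𝓞 ℚ) ∈ v.asIdeal →
        Finite {x : W.localTowerKerPrimary κ (v.adicCompletion ℚ) n // 2 • x = 0} ∧
          Nat.card {x : W.localTowerKerPrimary κ (v.adicCompletion ℚ) n // 2 • x = 0} ≤ C₂)
    (S : Finset (HeightOneSpectrum (𝓞 ℚ)))
    (hS : ∀ v ∉ S, ((2 : ℕ) : 𝓞 ℚ) ∉ v.asIdeal ∧ W.HasGoodReductionAt v)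
    (C : HeightOneSpectrum (𝓞 ℚ) → ℕ)
    (hC : ∀ v ∈ S, ((2 : ℕ) : 𝓞 ℚ) ∉ v.asIdeal →
      4 ≤ C v ∨ (W.HasMultiplicativeReductionAt v ∧ 2 ≤ C v) ∨
        (W.HasMultiplicativeReductionAt v ∧ ¬ 2 ∣ W.ordMinimalDiscriminant v ∧ 1 ≤ C v) ∨
        (W.HasGoodReductionAt v ∧ 1 ≤ C v) ∨
        (W.HasAdditiveReductionAt v ∧ ¬ 2 ∣ (W.kodairaSymbolAt v).componentGroupOrder ∧ 1 ≤ C v) ∨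
        (W.HasAdditiveReductionAt v ∧ (∀ m, W.kodairaSymbolAt v ≠ .Istar m) ∧ 2 ≤ C v))
    (hlow : ∀ (κ : ZpExtension ℚ 2) (γ : Field.absoluteGaloisGroup ℚ), κ.IsCyclotomic →
      κ.IsTopGenerator γ →
        2 ^ a ≤ Nat.card {z : W.selmerLayer κ n // 2 • z = 0 ∧
          (⇑(W.conjH1 2 (κ.layerSubgroup n) γ -
            AddMonoidHom.id (W.subgroupH1 2 (κ.layerSubgroup n))))^[m]
            (z : W.subgroupH1 2 (κ.layerSubgroup n)) = 0})
    (hup : ∀ (κ : ZpExtension ℚ 2) (γ : Field.absoluteGaloisGroup ℚ), κ.IsCyclotomic →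
      κ.IsTopGenerator γ →
        Nat.card {z : W.selmerLayer κ n // 2 • z = 0 ∧
          (⇑(W.conjH1 2 (κ.layerSubgroup n) γ -
            AddMonoidHom.id (W.subgroupH1 2 (κ.layerSubgroup n))))^[m + w]
            (z : W.subgroupH1 2 (κ.layerSubgroup n)) = 0} ≤ 2 ^ d)
    (harith : 2 ^ d * ∏ v ∈ S, (if ((2 : ℕ) : 𝓞 ℚ) ∈ v.asIdeal then C₂ else C v) ^
        (if ((2 : ℕ) : 𝓞 ℚ) ∈ v.asIdeal then 1
          else 2 ^ min n (padicValNat 2 (natGenerator v ^ 2 - 1) - 3)) <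
      2 ^ (w + a)) : TowerGapAtTwo W := by
  refine TowerFiltration.towerGapAtTwo_of_filtration_localKernelBounds_sharp W htors hmw S
    (fun v ↦ if ((2 : ℕ) : 𝓞 ℚ) ∈ v.asIdeal then C₂ else C v) hlow hup
    (fun κ hκ v hv ↦ h33g ℚ W 2 κ hκ v (hS v hv).1 (hS v hv).2 n) (fun κ hκ v hv ↦ ?_) harith
  by_cases h2v : ((2 : ℕ) : 𝓞 ℚ) ∈ v.asIdeal
  · rw [if_pos h2v]
    exact h2 κ hκ v h2v
  · rw [if_neg h2v]
    exact pTorsion_localTowerKer_le_of_numeric_addv2 W h33g hM hA κ hκ v h2v n (C v) (hC v hv h2v)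

/-- **The FILTRATION GAP certificate indexed by rational primes, the constant at `2` a DATUM, SIX disjuncts.** `P` a finite set of ODD
primes containing every odd prime of the minimal discriminant, `C : ℕ → ℕ` justified per `ℓ ∈ P` by one of six disjuncts (as in
`MultTowerAddv.towerGapAtTwo_of_layerSelmer_nat_atTwo_addv2`, proof verbatim); arithmetic
`2^d · C₂ · ∏_{ℓ ∈ P} C_ℓ^{2^{min(n, v₂(ℓ² − 1) − 3)}} < 2^{w + a}`.
[cite: GreenbergLNM1716, §3 Lemmas 3.3–3.5 (PDF pp. 86–90) and pp. 90–93] [cite: SilvermanAEC2009, VII.1 Prop. 1.3, VII.5.1] -/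
theorem towerGapAtTwo_of_filtration_nat_atTwo
    (h33g : lemma33_localTowerKerPrimary_eq_bot_of_good.{0})
    (hM : lemma33_localTowerKerPrimary_cyclic_of_multiplicative.{0})
    (hA : lemma33_natCard_localTowerKerPrimary_le_four_of_additive.{0})
    (htors : ¬ 2 ∣ W.torsionOrder) {n m w a d : ℕ} (hmw : m + w ≤ 2 ^ n) (C₂ : ℕ)
    (h2 : ∀ κ : ZpExtension ℚ 2, κ.IsCyclotomic → ∀ v : HeightOneSpectrum (𝓞 ℚ),
      ((2 : ℕ) : 𝓞 ℚ) ∈ v.asIdeal →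
        Finite {x : W.localTowerKerPrimary κ (v.adicCompletion ℚ) n // 2 • x = 0} ∧
          Nat.card {x : W.localTowerKerPrimary κ (v.adicCompletion ℚ) n // 2 • x = 0} ≤ C₂)
    (P : Finset ℕ) (hP : ∀ ℓ ∈ P, ℓ.Prime ∧ ℓ ≠ 2)
    (hΔ : ∀ ℓ : ℕ, ℓ.Prime → ℓ ≠ 2 → (ℓ : ℤ) ∣ W.minimalDiscriminantInt → ℓ ∈ P)
    (C : ℕ → ℕ)
    (hC : ∀ (ℓ : ℕ) [Fact ℓ.Prime], ℓ ∈ P →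
      4 ≤ C ℓ ∨ (W.HasMultiplicativeReductionAtPrime ℓ ∧ 2 ≤ C ℓ) ∨
        (W.HasMultiplicativeReductionAtPrime ℓ ∧ ¬ 2 ∣ padicValInt ℓ W.minimalDiscriminantInt ∧
          1 ≤ C ℓ) ∨
        (¬ (ℓ : ℤ) ∣ W.minimalDiscriminantInt ∧ 1 ≤ C ℓ) ∨
        ((∃ k : ℕ, (ℓ : ℤ) ∣ (integralModelInt W).c₄ ∧ (ℓ : ℤ) ^ k ∣ W.minimalDiscriminantInt ∧
            ¬ (ℓ : ℤ) ^ (k + 1) ∣ W.minimalDiscriminantInt ∧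
            (k = 2 ∨ k = 4 ∨ k = 5 ∨ (7 ≤ k ∧ k ≠ 9 ∧ (ℓ : ℤ) ^ k ∣ (integralModelInt W).c₄ ^ 3))) ∧ 1 ≤ C ℓ) ∨
        ((∃ k : ℕ, (ℓ : ℤ) ∣ (integralModelInt W).c₄ ∧ (ℓ : ℤ) ^ k ∣ W.minimalDiscriminantInt ∧
            ¬ (ℓ : ℤ) ^ (k + 1) ∣ W.minimalDiscriminantInt ∧ 1 ≤ k ∧ k ≠ 6 ∧ (ℓ : ℤ) ^ k ∣ (integralModelInt W).c₄ ^ 3) ∧ 2 ≤ C ℓ))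
    (hlow : ∀ (κ : ZpExtension ℚ 2) (γ : Field.absoluteGaloisGroup ℚ), κ.IsCyclotomic →
      κ.IsTopGenerator γ →
        2 ^ a ≤ Nat.card {z : W.selmerLayer κ n // 2 • z = 0 ∧
          (⇑(W.conjH1 2 (κ.layerSubgroup n) γ -
            AddMonoidHom.id (W.subgroupH1 2 (κ.layerSubgroup n))))^[m]
            (z : W.subgroupH1 2 (κ.layerSubgroup n)) = 0})
    (hup : ∀ (κ : ZpExtension ℚ 2) (γ : Field.absoluteGaloisGroup ℚ), κ.IsCyclotomic →
      κ.IsTopGenerator γ →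
        Nat.card {z : W.selmerLayer κ n // 2 • z = 0 ∧
          (⇑(W.conjH1 2 (κ.layerSubgroup n) γ -
            AddMonoidHom.id (W.subgroupH1 2 (κ.layerSubgroup n))))^[m + w]
            (z : W.subgroupH1 2 (κ.layerSubgroup n)) = 0} ≤ 2 ^ d)
    (harith : 2 ^ d * C₂ * ∏ ℓ ∈ P, C ℓ ^ 2 ^ min n (padicValNat 2 (ℓ ^ 2 - 1) - 3) <
      2 ^ (w + a)) : TowerGapAtTwo W := by
  -- the places (exactly as in tower-1 part 8 / GEN 4 / GEN 8)
  let pl : ℕ → HeightOneSpectrum (𝓞 ℚ) := fun ℓ ↦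
    if h : ℓ.Prime then (primesEquiv (R := 𝓞 ℚ)).symm ⟨ℓ, h⟩
      else (primesEquiv (R := 𝓞 ℚ)).symm ⟨2, Nat.prime_two⟩
  have hpl : ∀ {ℓ : ℕ}, ℓ.Prime → natGenerator (pl ℓ) = ℓ := fun {ℓ} h ↦ by
    simp only [pl, dif_pos h]
    exact congrArg Subtype.val ((primesEquiv (R := 𝓞 ℚ)).apply_symm_apply ⟨ℓ, h⟩)
  have hpl_inj : Set.InjOn pl P := by
    intro ℓ hℓ ℓ' hℓ' h
    have := congrArg natGenerator h
    rwa [hpl (hP ℓ hℓ).1, hpl (hP ℓ' hℓ').1] at this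
  let v₂ : HeightOneSpectrum (𝓞 ℚ) := pl 2
  have hv₂ : natGenerator v₂ = 2 := hpl Nat.prime_two
  have h2v₂ : ((2 : ℕ) : 𝓞 ℚ) ∈ v₂.asIdeal := (natCast_prime_mem_asIdeal_iff v₂ Nat.prime_two).mpr hv₂
  have hv₂_notMem : v₂ ∉ P.image pl := by
    intro h
    obtain ⟨ℓ, hℓ, hℓeq⟩ := Finset.mem_image.mp h
    have := congrArg natGenerator hℓeq
    rw [hpl (hP ℓ hℓ).1, hv₂] at this
    exact (hP ℓ hℓ).2 this
  -- odd places in the image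
  have hodd : ∀ {ℓ : ℕ}, ℓ ∈ P → ((2 : ℕ) : 𝓞 ℚ) ∉ (pl ℓ).asIdeal := fun {ℓ} hℓ h ↦ by
    rw [natCast_prime_mem_asIdeal_iff _ Nat.prime_two, hpl (hP ℓ hℓ).1] at h
    exact (hP ℓ hℓ).2 h
  let S : Finset (HeightOneSpectrum (𝓞 ℚ)) := insert v₂ (P.image pl)
  let Cv : HeightOneSpectrum (𝓞 ℚ) → ℕ := fun v ↦ C (natGenerator v)
  refine towerGapAtTwo_of_filtration_numeric_atTwo W h33g hM hA htors hmw C₂ h2 S ?_ Cv ?_ hlow hup ?_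
  · -- `hS`: off `S` every place is odd and good
    intro v hv
    have hgen := prime_natGenerator v
    haveI : Fact (natGenerator v).Prime := ⟨hgen⟩
    have hvpl : pl (natGenerator v) = v := by
      simp only [pl, dif_pos hgen]
      exact (primesEquiv (R := 𝓞 ℚ)).symm_apply_apply v
    have hne2 : natGenerator v ≠ 2 := by
      intro h
      apply hv
      rw [Finset.mem_insert]
      left
      rw [← hvpl]
      simp only [v₂, h]
    have hnotP : natGenerator v ∉ P := by
      intro h
      exact hv (Finset.mem_insert_of_mem (Finset.mem_image.mpr ⟨_, h, hvpl⟩))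
    refine ⟨fun h ↦ hne2 ((natCast_prime_mem_asIdeal_iff v Nat.prime_two).mp h), ?_⟩
    have hndvd : ¬ ((natGenerator v : ℕ) : ℤ) ∣ W.minimalDiscriminantInt :=
      fun h ↦ hnotP (hΔ _ hgen hne2 h)
    exact (hasGoodReductionAtPrime_iff_hasGoodReductionAt_ringOfIntegers (v := v) W).mp
      (hasGoodReductionAtPrime_of_not_dvd W (natGenerator v) hndvd)
  · -- `hC`: the numeric local constants at the odd places of `S`
    intro v hv h2
    rcases Finset.mem_insert.mp hv with rfl | hv'
    · exact absurd h2v₂ h2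
    obtain ⟨ℓ, hℓP, rfl⟩ := Finset.mem_image.mp hv'
    have hℓ := (hP ℓ hℓP).1
    haveI : Fact ℓ.Prime := ⟨hℓ⟩
    have hgen : natGenerator (pl ℓ) = ℓ := hpl hℓ
    haveI : Fact (Nat.Prime ((primesEquiv (pl ℓ) : Nat.Primes) : ℕ)) := ⟨(primesEquiv (pl ℓ)).2⟩
    have hpe : ((primesEquiv (pl ℓ) : Nat.Primes) : ℕ) = ℓ := hgen
    have hCv : Cv (pl ℓ) = C ℓ := by simp only [Cv, hgen]
    rw [hCv]
    rcases hC ℓ hℓP with h4 | ⟨hm, h2C⟩ | ⟨hm, hord, h1⟩ | ⟨hg, h1⟩ | ⟨⟨k, hc₄, hk, hk', hcases⟩, h1⟩ |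
        ⟨⟨k, hc₄, hk, hk', hk1, hk6, hj⟩, h2C⟩
    · exact Or.inl h4
    · refine Or.inr (Or.inl ⟨?_, h2C⟩)
      exact (hasMultiplicativeReductionAtPrime_iff_hasMultiplicativeReductionAt_ringOfIntegers
        (W := W) (pl ℓ)).mp ((hasMultiplicativeReductionAtPrime_congr W hpe).mpr hm)
    · refine Or.inr (Or.inr (Or.inl ⟨?_, ?_, h1⟩))
      · exact (hasMultiplicativeReductionAtPrime_iff_hasMultiplicativeReductionAt_ringOfIntegers
          (W := W) (pl ℓ)).mp ((hasMultiplicativeReductionAtPrime_congr W hpe).mpr hm)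
      · rwa [LocalTorsionMult.ordMinimalDiscriminant_eq_padicValInt W (pl ℓ) hpe]
    · refine Or.inr (Or.inr (Or.inr (Or.inl ⟨?_, h1⟩)))
      exact (hasGoodReductionAtPrime_iff_hasGoodReductionAt_ringOfIntegers (v := pl ℓ) W).mp
        ((hasGoodReductionAtPrime_congr W hpe).mpr (hasGoodReductionAtPrime_of_not_dvd W ℓ hg))
    · refine Or.inr (Or.inr (Or.inr (Or.inr (Or.inl ⟨?_, ?_, h1⟩))))
      · exact (hasAdditiveReductionAt_and_not_two_dvd_componentGroupOrder_of_cert W (pl ℓ) hpe (hP ℓ hℓP).2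
          hc₄ hk hk' hcases).1
      · exact (hasAdditiveReductionAt_and_not_two_dvd_componentGroupOrder_of_cert W (pl ℓ) hpe (hP ℓ hℓP).2
          hc₄ hk hk' hcases).2
    · refine Or.inr (Or.inr (Or.inr (Or.inr (Or.inr ⟨?_, ?_, h2C⟩))))
      · exact (hasAdditiveReductionAt_and_ne_Istar_of_cert W (pl ℓ) hpe (hP ℓ hℓP).2 hc₄ hk hk' hk1 hk6 hj).1
      · exact (hasAdditiveReductionAt_and_ne_Istar_of_cert W (pl ℓ) hpe (hP ℓ hℓP).2 hc₄ hk hk' hk1 hk6 hj).2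
  · -- the arithmetic, re-indexed by primes
    have hprod : ∏ v ∈ S, (if ((2 : ℕ) : 𝓞 ℚ) ∈ v.asIdeal then C₂ else Cv v) ^
        (if ((2 : ℕ) : 𝓞 ℚ) ∈ v.asIdeal then 1
          else 2 ^ min n (padicValNat 2 (natGenerator v ^ 2 - 1) - 3)) =
        C₂ * ∏ ℓ ∈ P, C ℓ ^ 2 ^ min n (padicValNat 2 (ℓ ^ 2 - 1) - 3) := by
      rw [Finset.prod_insert hv₂_notMem, if_pos h2v₂, if_pos h2v₂, pow_one,
        Finset.prod_image hpl_inj]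
      congr 1
      refine Finset.prod_congr rfl fun ℓ hℓ ↦ ?_
      rw [if_neg (hodd hℓ), if_neg (hodd hℓ)]
      simp only [Cv, hpl (hP ℓ hℓ).1]
    rw [hprod, ← mul_assoc]
    exact harith

/-- **The FILTRATION GAP certificate, every kernel-side datum decidable, the constant at `2` a DATUM, SIX disjuncts.** As
`MultTowerAddv.towerGapAtTwo_of_layerSelmer_cert_atTwo_addv2` (proof verbatim) with the two layer counts replaced by the two
filtered counts at ONE layer `n` (window `m + w ≤ 2ⁿ`) and the arithmetic `2^d · C₂ · ∏_{ℓ ∈ P} C_ℓ^{2^{min(n, e_ℓ)}} < 2^{w + a}`.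
[cite: GreenbergLNM1716, §3 Lemmas 3.3–3.5 (PDF pp. 86–90) and pp. 90–93] [cite: SilvermanATAEC1994, IV.9 Table 4.1] -/
theorem towerGapAtTwo_of_filtration_cert_atTwo
    (h33g : lemma33_localTowerKerPrimary_eq_bot_of_good.{0})
    (hM : lemma33_localTowerKerPrimary_cyclic_of_multiplicative.{0})
    (hA : lemma33_natCard_localTowerKerPrimary_le_four_of_additive.{0})
    (htors : ¬ 2 ∣ W.torsionOrder) {n m w a d : ℕ} (hmw : m + w ≤ 2 ^ n) (C₂ : ℕ)
    (h2 : ∀ κ : ZpExtension ℚ 2, κ.IsCyclotomic → ∀ v : HeightOneSpectrum (𝓞 ℚ),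
      ((2 : ℕ) : 𝓞 ℚ) ∈ v.asIdeal →
        Finite {x : W.localTowerKerPrimary κ (v.adicCompletion ℚ) n // 2 • x = 0} ∧
          Nat.card {x : W.localTowerKerPrimary κ (v.adicCompletion ℚ) n // 2 • x = 0} ≤ C₂)
    (P : Finset ℕ) (hP : ∀ ℓ ∈ P, ℓ.Prime ∧ ℓ ≠ 2)
    (hΔ : ∀ ℓ : ℕ, ℓ.Prime → ℓ ≠ 2 → (ℓ : ℤ) ∣ W.minimalDiscriminantInt → ℓ ∈ P)
    (C e k : ℕ → ℕ) (he : ∀ ℓ ∈ P, ¬ 2 ^ (e ℓ + 4) ∣ ℓ ^ 2 - 1)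
    (hC : ∀ (ℓ : ℕ) [Fact ℓ.Prime], ℓ ∈ P →
      4 ≤ C ℓ ∨ (W.HasMultiplicativeReductionAtPrime ℓ ∧ 2 ≤ C ℓ) ∨
        (W.HasMultiplicativeReductionAtPrime ℓ ∧ (ℓ : ℤ) ^ k ℓ ∣ W.minimalDiscriminantInt ∧
          ¬ (ℓ : ℤ) ^ (k ℓ + 1) ∣ W.minimalDiscriminantInt ∧ ¬ 2 ∣ k ℓ ∧ 1 ≤ C ℓ) ∨
        (¬ (ℓ : ℤ) ∣ W.minimalDiscriminantInt ∧ 1 ≤ C ℓ) ∨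
        ((ℓ : ℤ) ∣ (integralModelInt W).c₄ ∧ (ℓ : ℤ) ^ k ℓ ∣ W.minimalDiscriminantInt ∧
          ¬ (ℓ : ℤ) ^ (k ℓ + 1) ∣ W.minimalDiscriminantInt ∧
          (k ℓ = 2 ∨ k ℓ = 4 ∨ k ℓ = 5 ∨ (7 ≤ k ℓ ∧ k ℓ ≠ 9 ∧ (ℓ : ℤ) ^ k ℓ ∣ (integralModelInt W).c₄ ^ 3)) ∧ 1 ≤ C ℓ) ∨
        ((ℓ : ℤ) ∣ (integralModelInt W).c₄ ∧ (ℓ : ℤ) ^ k ℓ ∣ W.minimalDiscriminantInt ∧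
          ¬ (ℓ : ℤ) ^ (k ℓ + 1) ∣ W.minimalDiscriminantInt ∧ 1 ≤ k ℓ ∧ k ℓ ≠ 6 ∧
          (ℓ : ℤ) ^ k ℓ ∣ (integralModelInt W).c₄ ^ 3 ∧ 2 ≤ C ℓ))
    (hlow : ∀ (κ : ZpExtension ℚ 2) (γ : Field.absoluteGaloisGroup ℚ), κ.IsCyclotomic →
      κ.IsTopGenerator γ →
        2 ^ a ≤ Nat.card {z : W.selmerLayer κ n // 2 • z = 0 ∧
          (⇑(W.conjH1 2 (κ.layerSubgroup n) γ -
            AddMonoidHom.id (W.subgroupH1 2 (κ.layerSubgroup n))))^[m]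
            (z : W.subgroupH1 2 (κ.layerSubgroup n)) = 0})
    (hup : ∀ (κ : ZpExtension ℚ 2) (γ : Field.absoluteGaloisGroup ℚ), κ.IsCyclotomic →
      κ.IsTopGenerator γ →
        Nat.card {z : W.selmerLayer κ n // 2 • z = 0 ∧
          (⇑(W.conjH1 2 (κ.layerSubgroup n) γ -
            AddMonoidHom.id (W.subgroupH1 2 (κ.layerSubgroup n))))^[m + w]
            (z : W.subgroupH1 2 (κ.layerSubgroup n)) = 0} ≤ 2 ^ d)
    (harith : 2 ^ d * C₂ * ∏ ℓ ∈ P, C ℓ ^ 2 ^ min n (e ℓ) < 2 ^ (w + a)) :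
    TowerGapAtTwo W := by
  -- `1 ≤ C ℓ` on `P`
  have hC1 : ∀ ℓ ∈ P, 1 ≤ C ℓ := by
    intro ℓ hℓ
    haveI : Fact ℓ.Prime := ⟨(hP ℓ hℓ).1⟩
    rcases hC ℓ hℓ with h | ⟨-, h⟩ | ⟨-, -, -, -, h⟩ | ⟨-, h⟩ | ⟨-, -, -, -, h⟩ | ⟨-, -, -, -, -, -, h⟩ <;> omega
  refine towerGapAtTwo_of_filtration_nat_atTwo W h33g hM hA htors hmw C₂ h2 P hP hΔ C
    (fun ℓ _ hℓ ↦ ?_) hlow hup (lt_of_le_of_lt ?_ harith)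
  · rcases hC ℓ hℓ with h | h | ⟨hm, h1, h2', hodd, hC'⟩ | h | ⟨hc₄, h1, h2', hcases, hC'⟩ |
        ⟨hc₄, h1, h2', hk1, hk6, hj, hC'⟩
    · exact Or.inl h
    · exact Or.inr (Or.inl h)
    · refine Or.inr (Or.inr (Or.inl ⟨hm, ?_, hC'⟩))
      rwa [padicValInt_eq_of_dvd_of_not_dvd h1 h2']
    · exact Or.inr (Or.inr (Or.inr (Or.inl h)))
    · exact Or.inr (Or.inr (Or.inr (Or.inr (Or.inl ⟨⟨k ℓ, hc₄, h1, h2', hcases⟩, hC'⟩))))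
    · exact Or.inr (Or.inr (Or.inr (Or.inr (Or.inr ⟨⟨k ℓ, hc₄, h1, h2', hk1, hk6, hj⟩, hC'⟩))))
  · refine Nat.mul_le_mul_left _ (Finset.prod_le_prod (fun ℓ _ ↦ Nat.zero_le _) fun ℓ hℓ ↦ ?_)
    refine Nat.pow_le_pow_right (hC1 ℓ hℓ) (Nat.pow_le_pow_right (by norm_num) ?_)
    have hℓ2 : ℓ ^ 2 - 1 ≠ 0 := by
      have h3 : 2 ≤ ℓ := (hP ℓ hℓ).1.two_le
      have : 4 ≤ ℓ ^ 2 := by nlinarith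
      omega
    exact min_le_min_left _ (padicValNat_sq_sub_one_sub_three_le hℓ2 (he ℓ hℓ))

end Gap

end Summit.BirchSwinnertonDyer.BirchSwinnertonDyer.Theorems.MultTowerFilt

end
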